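import Summits.AtomisticToContinuum.HydrodynamicLimit.Theorems.InfluenceLocality.Negative.Certification

/-!
# `InfluenceLocality` (stmt-AtomisticToContinuum-13916) — kill criterion and load-bearing
hypotheses

Sorry-free §A–§D of the standing disprover's work file `Cruxes/InfluenceLocality/Disproof.lean`
(refuter-cdisprove-stmt-AtomisticToContinuum-13916-0, 2026-08-16): the quantifier shell
(`influenceLocality_iff` is `Iff.rfl`), weak regimes `bound_of_lam_le_delta` (any range `R`) and
`bound_of_T_neg`, the Chebyshev form `measure_le_of_bound`, the split `lintegral_ge_split`, the
KILL CRITERION `not_influenceLocality_of_witness`, the strengthenings `WithoutDelta` (`δ = 0`) and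
`UniformInLam` (`∃ R ∀ lam`) — both imply the crux and both are false MODULO the dynamical
facts `CorruptionEvent` / `TypicalBadFraction` / `PositiveBadFraction` — and the eventual-in-`R`
shape `InfluenceLocalityEventually → InfluenceLocality` (what the consumer stmt-13917 actually
needs; badness is not monotone in `R`). Nothing here asserts a Theses decl positively.
-/

namespace Summit.AtomisticToContinuum.HydrodynamicLimit.Theorems.InfluenceLocality.Negative

open MeasureTheory Set
open scoped Classical ENNReal
open Literature.Analysis.FluidPDE Literature.MathematicalPhysics.KineticTheory
open Summit.AtomisticToContinuum.HydrodynamicLimit.Theses.AntiMazurCoboundaries (InfluenceLocality)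

noncomputable section

/-- The innermost inequality of the crux at fixed parameters. -/
def Bound (a θ : ℝ) (u₀ : V3) (σ T lam δ R : ℝ) (N : ℕ) (Φ : Flow σ N) (Ψ : ClusterFlows σ N) :
    Prop :=
  ∫⁻ z, ENNReal.ofReal (Real.exp (lam * (badCount σ T R N Φ Ψ z : ℝ))) ∂(gibbs σ a θ u₀ N Φ)
    ≤ ENNReal.ofReal (Real.exp (δ * (N + 1)))

/-- READ-BACK: the crux is, by `Iff.rfl`, the quantifier shell
`∀ a θ u₀ > 0 ∃ σ₀ ∀ σ ∈ (0, σ₀) ∀ T lam δ > 0 ∃ R > 0 ∃ N₀ ∀ N ≥ N₀ ∀ Φ ∀ Ψ` around `Bound`. [folklore] -/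
theorem influenceLocality_iff :
    InfluenceLocality ↔ ∀ (a θ : ℝ) (u₀ : V3), 0 < a → 0 < θ → ∃ σ₀ : ℝ, 0 < σ₀ ∧ ∀ σ : ℝ,
      0 < σ → σ < σ₀ → ∀ (T lam δ : ℝ), 0 < T → 0 < lam → 0 < δ → ∃ R : ℝ, 0 < R ∧ ∃ N₀ : ℕ,
      ∀ N : ℕ, N₀ ≤ N → ∀ (Φ : Flow σ N) (Ψ : ClusterFlows σ N), Bound a θ u₀ σ T lam δ R N Φ Ψ :=
  Iff.rfl

/-! ## (A) Load-bearing analysis -/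

/-- At most all `N + 1` spheres are bad. [folklore] -/
theorem badCount_le (σ T R : ℝ) (N : ℕ) (Φ : Flow σ N) (Ψ : ClusterFlows σ N)
    (z : Config (N + 1) (Fin 3) T3) : badCount σ T R N Φ Ψ z ≤ N + 1 := by
  unfold badCount
  calc _ ≤ Finset.univ.card := Finset.card_filter_le _ _
    _ = N + 1 := by simp

/-- `G_N` is a probability measure for `σ ≤ 1/2` (tree: `isProbabilityMeasure_localGibbsLaw`). [folklore] -/
theorem isProbabilityMeasure_gibbs {σ a θ : ℝ} (u₀ : V3) (ha : 0 < a) (hθ : 0 < θ)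
    (hσ : σ ≤ 1 / 2) (N : ℕ) (Φ : Flow σ N) : IsProbabilityMeasure (gibbs σ a θ u₀ N Φ) :=
  isProbabilityMeasure_localGibbsLaw continuous_const continuous_const continuous_const
    (fun _ => ha) (fun _ => hθ) hσ N Φ

/-- WEAK REGIME `lam ≤ δ` (first proved by refuter-rattack, `Evidence.weak_regime`, re-proved
here to keep this file self-contained): the bound holds for EVERY range `R`, horizon `T`, `N`,
`Φ`, `Ψ`, because `#bad ≤ N + 1` and `G_N` is a probability measure (`σ ≤ 1/2`). All the
content of the crux is in the regime `lam > δ`. [folklore] -/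
theorem bound_of_lam_le_delta {σ a θ T lam δ R : ℝ} {u₀ : V3} (ha : 0 < a) (hθ : 0 < θ)
    (hσ : σ ≤ 1 / 2) (hlam : 0 ≤ lam) (h : lam ≤ δ) (N : ℕ) (Φ : Flow σ N)
    (Ψ : ClusterFlows σ N) : Bound a θ u₀ σ T lam δ R N Φ Ψ := by
  haveI := isProbabilityMeasure_gibbs u₀ ha hθ hσ N Φ
  unfold Bound
  calc ∫⁻ z, ENNReal.ofReal (Real.exp (lam * (badCount σ T R N Φ Ψ z : ℝ))) ∂(gibbs σ a θ u₀ N Φ)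
      ≤ ∫⁻ _z, ENNReal.ofReal (Real.exp (δ * (N + 1))) ∂(gibbs σ a θ u₀ N Φ) := by
        refine lintegral_mono fun z => ENNReal.ofReal_le_ofReal (Real.exp_le_exp.2 ?_)
        have h1 : (badCount σ T R N Φ Ψ z : ℝ) ≤ N + 1 := by
          exact_mod_cast badCount_le σ T R N Φ Ψ z
        calc lam * (badCount σ T R N Φ Ψ z : ℝ) ≤ lam * (N + 1) :=
              mul_le_mul_of_nonneg_left h1 hlam
          _ ≤ δ * (N + 1) := mul_le_mul_of_nonneg_right h (by positivity)
    _ = ENNReal.ofReal (Real.exp (δ * (N + 1))) := by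
        rw [lintegral_const, measure_univ, mul_one]

/-- DECORATION `0 < T`, part 1: for `T < 0` the window `[0, Tℓ]` is empty, nobody is bad. [folklore] -/
theorem badCount_eq_zero_of_T_neg {σ T R : ℝ} (hT : T < 0) (N : ℕ) (Φ : Flow σ N)
    (Ψ : ClusterFlows σ N) (z : Config (N + 1) (Fin 3) T3) : badCount σ T R N Φ Ψ z = 0 := by
  unfold badCount
  have hℓ : 0 < ell N := Real.rpow_pos_of_pos (by positivity) _
  have hneg : T * ell N < 0 := mul_neg_of_neg_of_pos hT hℓ
  simp [Set.Icc_eq_empty_of_lt hneg]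

/-- DECORATION `0 < T`, part 2: for `T < 0` the bound holds for every `R`, `lam`, `δ ≥ 0`. (At
`T = 0` it also holds, `G_N`-a.e. `Φ.flow 0 z = z` and `localClusterState Ψ r 0 z i = z i`
(`HardSphereFlow.flow_zero`, `localClusterState_zero`); not formalised here: it needs the
absolute continuity of the push-forwards of `G_N` under the cluster restrictions.) [folklore] -/
theorem bound_of_T_neg {σ a θ T lam δ R : ℝ} {u₀ : V3} (ha : 0 < a) (hθ : 0 < θ)
    (hσ : σ ≤ 1 / 2) (hT : T < 0) (hδ : 0 ≤ δ) (N : ℕ) (Φ : Flow σ N) (Ψ : ClusterFlows σ N) :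
    Bound a θ u₀ σ T lam δ R N Φ Ψ := by
  haveI := isProbabilityMeasure_gibbs u₀ ha hθ hσ N Φ
  unfold Bound
  simp only [badCount_eq_zero_of_T_neg hT, Nat.cast_zero, mul_zero, Real.exp_zero,
    ENNReal.ofReal_one, lintegral_const, measure_univ, mul_one]
  exact ENNReal.one_le_ofReal.2 (Real.one_le_exp (by positivity))

/-! ## (B) The kill criterion (Chebyshev form of the bound) -/

/-- CHEBYSHEV: the bound at `(lam, δ)` forces every measurable event on which at least `m`
particles are bad to have `G_N`-probability `≤ exp(δ(N+1) − lam·m)`. [folklore] -/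
theorem measure_le_of_bound {σ a θ T lam δ R : ℝ} {u₀ : V3} {N : ℕ} {Φ : Flow σ N}
    {Ψ : ClusterFlows σ N} (hB : Bound a θ u₀ σ T lam δ R N Φ Ψ) (hlam : 0 ≤ lam)
    {A : Set (Config (N + 1) (Fin 3) T3)} (hA : MeasurableSet A) {m : ℕ}
    (hm : ∀ z ∈ A, m ≤ badCount σ T R N Φ Ψ z) :
    gibbs σ a θ u₀ N Φ A ≤ ENNReal.ofReal (Real.exp (δ * (N + 1) - lam * m)) := by
  have key : ENNReal.ofReal (Real.exp (lam * m)) * gibbs σ a θ u₀ N Φ A ≤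
      ENNReal.ofReal (Real.exp (δ * (N + 1))) := by
    calc ENNReal.ofReal (Real.exp (lam * m)) * gibbs σ a θ u₀ N Φ A
        = ∫⁻ z, A.indicator (fun _ => ENNReal.ofReal (Real.exp (lam * m))) z
            ∂(gibbs σ a θ u₀ N Φ) := (lintegral_indicator_const hA _).symm
      _ ≤ ∫⁻ z, ENNReal.ofReal (Real.exp (lam * (badCount σ T R N Φ Ψ z : ℝ)))
            ∂(gibbs σ a θ u₀ N Φ) := by
          refine lintegral_mono fun z => ?_
          by_cases hz : z ∈ A
          · simp only [Set.indicator_of_mem hz]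
            refine ENNReal.ofReal_le_ofReal (Real.exp_le_exp.2 ?_)
            exact mul_le_mul_of_nonneg_left (by exact_mod_cast hm z hz) hlam
          · simp only [Set.indicator_of_notMem hz, zero_le]
      _ ≤ _ := hB
  rw [Real.exp_sub, ENNReal.ofReal_div_of_pos (Real.exp_pos _),
    ENNReal.le_div_iff_mul_le (Or.inl (ENNReal.ofReal_pos.2 (Real.exp_pos _)).ne')
      (Or.inl ENNReal.ofReal_ne_top), mul_comm]
  exact key

/-- THE KILL CRITERION (contrapositive of `measure_le_of_bound` through the quantifier shell):
to refute the crux it suffices to exhibit, for some admissible `(a, θ, u₀)`, arbitrarily small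
`σ`, one `(T, lam, δ)`, and for EVERY range `R` and threshold `N₀`, a particle number `N ≥ N₀`,
flows, and a measurable event `A` with `#bad ≥ m` on `A` and `G_N(A) > exp(δ(N+1) − lam·m)` —
i.e. bad fractions `m/(N+1) = ε` at LD cost per bad particle `< lam − δ/ε`, UNIFORMLY IN `R`. [folklore] -/
theorem not_influenceLocality_of_witness
    (h : ∃ (a θ : ℝ) (u₀ : V3), 0 < a ∧ 0 < θ ∧ ∀ σ₀ : ℝ, 0 < σ₀ → ∃ σ : ℝ, 0 < σ ∧ σ < σ₀ ∧
      ∃ (T lam δ : ℝ), 0 < T ∧ 0 < lam ∧ 0 < δ ∧ ∀ R : ℝ, 0 < R → ∀ N₀ : ℕ, ∃ N : ℕ, N₀ ≤ N ∧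
      ∃ (Φ : Flow σ N) (Ψ : ClusterFlows σ N) (A : Set (Config (N + 1) (Fin 3) T3)) (m : ℕ),
        MeasurableSet A ∧ (∀ z ∈ A, m ≤ badCount σ T R N Φ Ψ z) ∧
        ENNReal.ofReal (Real.exp (δ * (N + 1) - lam * m)) < gibbs σ a θ u₀ N Φ A) :
    ¬ InfluenceLocality := by
  rw [influenceLocality_iff]
  rintro hIL
  obtain ⟨a, θ, u₀, ha, hθ, h⟩ := h
  obtain ⟨σ₀, hσ₀, hσ⟩ := hIL a θ u₀ ha hθ
  obtain ⟨σ, hσpos, hσlt, T, lam, δ, hT, hlam, hδ, hR⟩ := h σ₀ hσ₀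
  obtain ⟨R, hRpos, N₀, hN⟩ := hσ σ hσpos hσlt T lam δ hT hlam hδ
  obtain ⟨N, hN₀, Φ, Ψ, A, m, hA, hm, hlt⟩ := hR R hRpos N₀
  exact (not_le.2 hlt) (measure_le_of_bound (hN N hN₀ Φ Ψ) hlam.le hA hm)


/-- LOWER SPLIT: on a probability space, an event `A` carrying at least `m` bad particles pushes
the exponential moment up to `G(Aᶜ) + e^{lam m}·G(A) = 1 + (e^{lam m} − 1)·G(A)`. [folklore] -/
theorem lintegral_ge_split {σ a θ T lam R : ℝ} {u₀ : V3} {N : ℕ} {Φ : Flow σ N}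
    {Ψ : ClusterFlows σ N} (hlam : 0 ≤ lam) {A : Set (Config (N + 1) (Fin 3) T3)}
    (hA : MeasurableSet A) {m : ℕ} (hm : ∀ z ∈ A, m ≤ badCount σ T R N Φ Ψ z) :
    gibbs σ a θ u₀ N Φ Aᶜ + ENNReal.ofReal (Real.exp (lam * m)) * gibbs σ a θ u₀ N Φ A ≤
      ∫⁻ z, ENNReal.ofReal (Real.exp (lam * (badCount σ T R N Φ Ψ z : ℝ))) ∂(gibbs σ a θ u₀ N Φ) := by
  have h1 : gibbs σ a θ u₀ N Φ Aᶜ = ∫⁻ z, Aᶜ.indicator (fun _ => (1 : ℝ≥0∞)) z ∂(gibbs σ a θ u₀ N Φ) := by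
    rw [lintegral_indicator_const hA.compl, one_mul]
  have h2 : ENNReal.ofReal (Real.exp (lam * m)) * gibbs σ a θ u₀ N Φ A =
      ∫⁻ z, A.indicator (fun _ => ENNReal.ofReal (Real.exp (lam * m))) z ∂(gibbs σ a θ u₀ N Φ) :=
    (lintegral_indicator_const hA _).symm
  rw [h1, h2, ← lintegral_add_left (measurable_const.indicator hA.compl)]
  refine lintegral_mono fun z => ?_
  by_cases hz : z ∈ A
  · simp only [Set.indicator_of_notMem (Set.notMem_compl_iff.2 hz), Set.indicator_of_mem hz,
      zero_add]
    refine ENNReal.ofReal_le_ofReal (Real.exp_le_exp.2 ?_)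
    exact mul_le_mul_of_nonneg_left (by exact_mod_cast hm z hz) hlam
  · simp only [Set.indicator_of_mem (Set.mem_compl hz), Set.indicator_of_notMem hz, add_zero]
    exact ENNReal.one_le_ofReal.2 (Real.one_le_exp (mul_nonneg hlam (Nat.cast_nonneg _)))

/-! ## (C) Natural strengthenings and the dynamical input their refutation needs

Every refutation of a variant of the crux needs ONE dynamical fact about the actual hard-sphere
flow (the tree HAS the flow: `HardSphereFlow.nonempty_torus_holds`, Alexander's theorem, proved):
a `G_N`-non-negligible event on which forecasts are provably corrupted. We isolate the two
weakest such facts as hypotheses and prove the refutations MODULO them; the facts themselves are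
the near-misses of §(E). -/

-- `CorruptionEvent` is declared in `Negative/Certification.lean` (imported).

/-- DYNAMICAL INPUT 2 (a bad FRACTION is typical at fixed range): at `(σ, T, R)` there are a
fraction `ε > 0` and `N₀` such that for `N ≥ N₀` some flows make `#bad ≥ ε(N+1)` with
`G_N`-probability `≥ 1/2`. Physically: `#bad/(N+1) → p_bad(σ,T,R) > 0` in probability (law of
large numbers for a local observable of a Gibbs state with good mixing at small `σ`). -/
def TypicalBadFraction (a θ : ℝ) (u₀ : V3) (σ T R : ℝ) : Prop :=
  ∃ ε : ℝ, 0 < ε ∧ ∃ N₀ : ℕ, ∀ N : ℕ, N₀ ≤ N → ∃ (Φ : Flow σ N) (Ψ : ClusterFlows σ N)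
    (A : Set (Config (N + 1) (Fin 3) T3)) (m : ℕ), MeasurableSet A ∧ ε * (N + 1) ≤ m ∧
    (∀ z ∈ A, m ≤ badCount σ T R N Φ Ψ z) ∧ 2⁻¹ ≤ gibbs σ a θ u₀ N Φ A

/-- STRENGTHENING 1 — NO SLACK (`δ = 0`): `∫ exp(lam·#bad) dG_N ≤ 1`. -/
def WithoutDelta : Prop :=
  ∀ (a θ : ℝ) (u₀ : V3), 0 < a → 0 < θ → ∃ σ₀ : ℝ, 0 < σ₀ ∧ ∀ σ : ℝ, 0 < σ → σ < σ₀ →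
    ∀ (T lam : ℝ), 0 < T → 0 < lam → ∃ R : ℝ, 0 < R ∧ ∃ N₀ : ℕ, ∀ N : ℕ, N₀ ≤ N →
    ∀ (Φ : Flow σ N) (Ψ : ClusterFlows σ N), Bound a θ u₀ σ T lam 0 R N Φ Ψ

/-- `WithoutDelta` is a strengthening of the crux (the bound is monotone in `δ`). [folklore] -/
theorem influenceLocality_of_withoutDelta (h : WithoutDelta) : InfluenceLocality := by
  rw [influenceLocality_iff]
  intro a θ u₀ ha hθ
  obtain ⟨σ₀, hσ₀, hσ⟩ := h a θ u₀ ha hθ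
  refine ⟨σ₀, hσ₀, fun σ hs hs' T lam δ hT hlam hδ => ?_⟩
  obtain ⟨R, hR, N₀, hN⟩ := hσ σ hs hs' T lam hT hlam
  refine ⟨R, hR, N₀, fun N hN₀ Φ Ψ => (hN N hN₀ Φ Ψ).trans ?_⟩
  exact ENNReal.ofReal_le_ofReal (Real.exp_le_exp.2 (by nlinarith [hδ.le]))

/-- `δ > 0` IS LOAD-BEARING (modulo dynamical input 1): if corruption events of `N`-independent
positive probability exist at every small `σ` for `T = 1` and every range `R`, the no-slack
version is false — `∫ exp(lam·#bad) ≥ 1 + (e^{lam} − 1)·p > 1`. [folklore] -/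
theorem withoutDelta_false_of_corruption
    (h : ∀ σ₀ : ℝ, 0 < σ₀ → ∃ σ : ℝ, 0 < σ ∧ σ < σ₀ ∧ σ ≤ 1 / 2 ∧
      ∀ R : ℝ, 0 < R → CorruptionEvent 1 1 0 σ 1 R) :
    ¬ WithoutDelta := by
  intro hW
  obtain ⟨σ₀, hσ₀, hσ⟩ := hW 1 1 0 one_pos one_pos
  obtain ⟨σ, hs, hs', hs2, hR⟩ := h σ₀ hσ₀
  obtain ⟨R, hRpos, N₀, hN⟩ := hσ σ hs hs' 1 1 one_pos one_pos
  obtain ⟨p, hp, N₁, hN₁⟩ := hR R hRpos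
  obtain ⟨Φ, Ψ, A, hA, hbad, hpA⟩ := hN₁ (max N₀ N₁) (le_max_right _ _)
  have hB := hN (max N₀ N₁) (le_max_left _ _) Φ Ψ
  haveI := isProbabilityMeasure_gibbs (σ := σ) (a := 1) (θ := 1) (0 : V3) one_pos one_pos hs2
    (max N₀ N₁) Φ
  have hsplit := lintegral_ge_split (σ := σ) (a := 1) (θ := 1) (u₀ := (0 : V3)) (T := 1)
    (lam := 1) (R := R) (Φ := Φ) (Ψ := Ψ) zero_le_one hA (m := 1) hbad
  unfold Bound at hB
  have hle := hsplit.trans hB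
  simp only [zero_mul, Real.exp_zero, ENNReal.ofReal_one, Nat.cast_one, mul_one] at hle
  -- hle : G Aᶜ + ofReal (exp 1) * G A ≤ 1
  have hcompl : gibbs σ 1 1 0 (max N₀ N₁) Φ Aᶜ = 1 - gibbs σ 1 1 0 (max N₀ N₁) Φ A :=
    prob_compl_eq_one_sub hA
  have hA1 : gibbs σ 1 1 0 (max N₀ N₁) Φ A ≤ 1 := prob_le_one
  have hAtop : gibbs σ 1 1 0 (max N₀ N₁) Φ A ≠ ∞ := ne_top_of_le_ne_top ENNReal.one_ne_top hA1
  rw [hcompl] at hle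
  -- 1 - G A + e * G A ≤ 1  ⇒ (e - 1) * G A ≤ 0 ⇒ G A = 0, contradicting p ≤ G A, 0 < p
  have hGA0 : gibbs σ 1 1 0 (max N₀ N₁) Φ A = 0 := by
    by_contra hne
    have hpos : 0 < gibbs σ 1 1 0 (max N₀ N₁) Φ A := pos_iff_ne_zero.2 hne
    have hgt : (1 : ℝ≥0∞) < 1 - gibbs σ 1 1 0 (max N₀ N₁) Φ A +
        ENNReal.ofReal (Real.exp 1) * gibbs σ 1 1 0 (max N₀ N₁) Φ A := by
      have he : (1 : ℝ≥0∞) < ENNReal.ofReal (Real.exp 1) := by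
        rw [← ENNReal.ofReal_one]
        exact (ENNReal.ofReal_lt_ofReal_iff (Real.exp_pos 1)).2 (by
          have := Real.add_one_lt_exp (x := (1 : ℝ)) one_ne_zero; linarith)
      calc (1 : ℝ≥0∞) = 1 - gibbs σ 1 1 0 (max N₀ N₁) Φ A + 1 * gibbs σ 1 1 0 (max N₀ N₁) Φ A := by
            rw [one_mul, tsub_add_cancel_of_le hA1]
        _ < 1 - gibbs σ 1 1 0 (max N₀ N₁) Φ A +
            ENNReal.ofReal (Real.exp 1) * gibbs σ 1 1 0 (max N₀ N₁) Φ A := by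
            refine ENNReal.add_lt_add_left ?_ ?_
            · exact ne_top_of_le_ne_top ENNReal.one_ne_top tsub_le_self
            · have hmul := ENNReal.mul_lt_mul_right hne hAtop he
              simpa only [mul_comm] using hmul
    exact (not_lt.2 hle) hgt
  exact (lt_irrefl 0) (hp.trans_le (hpA.trans_eq hGA0))

/-- STRENGTHENING 2 — RANGE BEFORE RATE (`∃ R ∀ lam`). -/
def UniformInLam : Prop :=
  ∀ (a θ : ℝ) (u₀ : V3), 0 < a → 0 < θ → ∃ σ₀ : ℝ, 0 < σ₀ ∧ ∀ σ : ℝ, 0 < σ → σ < σ₀ →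
    ∀ (T δ : ℝ), 0 < T → 0 < δ → ∃ R : ℝ, 0 < R ∧ ∀ lam : ℝ, 0 < lam → ∃ N₀ : ℕ, ∀ N : ℕ,
    N₀ ≤ N → ∀ (Φ : Flow σ N) (Ψ : ClusterFlows σ N), Bound a θ u₀ σ T lam δ R N Φ Ψ

/-- `UniformInLam` is a strengthening of the crux (pure quantifier exchange). [folklore] -/
theorem influenceLocality_of_uniformInLam (h : UniformInLam) : InfluenceLocality := by
  rw [influenceLocality_iff]
  intro a θ u₀ ha hθ
  obtain ⟨σ₀, hσ₀, hσ⟩ := h a θ u₀ ha hθ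
  refine ⟨σ₀, hσ₀, fun σ hs hs' T lam δ hT hlam hδ => ?_⟩
  obtain ⟨R, hR, hl⟩ := hσ σ hs hs' T δ hT hδ
  obtain ⟨N₀, hN⟩ := hl lam hlam
  exact ⟨R, hR, N₀, hN⟩

/-- THE ORDER `lam` BEFORE `R` IS LOAD-BEARING (modulo dynamical input 2): if at every small `σ`,
for `T = 1` and every range `R`, a positive bad fraction `ε(R)` is typical, then `UniformInLam`
is false — Chebyshev at `lam = 4δ/ε` gives `G_N(#bad ≥ ε(N+1)) ≤ e^{-3δ(N+1)} < 1/2`. [folklore] -/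
theorem uniformInLam_false_of_typicalBadFraction
    (h : ∀ σ₀ : ℝ, 0 < σ₀ → ∃ σ : ℝ, 0 < σ ∧ σ < σ₀ ∧
      ∀ R : ℝ, 0 < R → TypicalBadFraction 1 1 0 σ 1 R) :
    ¬ UniformInLam := by
  intro hU
  obtain ⟨σ₀, hσ₀, hσ⟩ := hU 1 1 0 one_pos one_pos
  obtain ⟨σ, hs, hs', hR⟩ := h σ₀ hσ₀
  obtain ⟨R, hRpos, hl⟩ := hσ σ hs hs' 1 1 one_pos one_pos
  obtain ⟨ε, hε, N₁, hN₁⟩ := hR R hRpos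
  obtain ⟨N₀, hN⟩ := hl (4 / ε) (by positivity)
  obtain ⟨Φ, Ψ, A, m, hA, hεm, hbad, hhalf⟩ := hN₁ (max N₀ N₁) (le_max_right _ _)
  have hB := hN (max N₀ N₁) (le_max_left _ _) Φ Ψ
  have hcheb := measure_le_of_bound hB (by positivity) hA hbad
  -- exponent: 1 * (N+1) - (4/ε) * m ≤ (N+1) - 4 (N+1) = -3 (N+1) ≤ -3
  have hexp : (1 : ℝ) * ((max N₀ N₁ : ℕ) + 1) - 4 / ε * m ≤ -3 := by
    have h4 : 4 / ε * (ε * ((max N₀ N₁ : ℕ) + 1)) ≤ 4 / ε * m :=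
      mul_le_mul_of_nonneg_left hεm (by positivity)
    have h4' : 4 / ε * (ε * ((max N₀ N₁ : ℕ) + 1)) = 4 * ((max N₀ N₁ : ℕ) + 1) := by
      field_simp
    have hN0 : (0 : ℝ) ≤ (max N₀ N₁ : ℕ) := Nat.cast_nonneg _
    nlinarith
  have hlt : ENNReal.ofReal (Real.exp ((1 : ℝ) * ((max N₀ N₁ : ℕ) + 1) - 4 / ε * m)) < 2⁻¹ := by
    have h3 : Real.exp (-3 : ℝ) < 2⁻¹ := by
      have h := Real.exp_one_gt_d9
      have hpos := Real.exp_pos (1 : ℝ)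
      rw [show (-3 : ℝ) = -(3 : ℝ) by ring, Real.exp_neg]
      rw [show (3 : ℝ) = 1 + 1 + 1 by norm_num, Real.exp_add, Real.exp_add]
      rw [inv_lt_comm₀ (by positivity) (by norm_num)]
      nlinarith
    calc ENNReal.ofReal (Real.exp ((1 : ℝ) * ((max N₀ N₁ : ℕ) + 1) - 4 / ε * m))
        ≤ ENNReal.ofReal (Real.exp (-3)) := ENNReal.ofReal_le_ofReal (Real.exp_le_exp.2 hexp)
      _ < ENNReal.ofReal (2⁻¹ : ℝ) := (ENNReal.ofReal_lt_ofReal_iff (by norm_num)).2 h3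
      _ = 2⁻¹ := by rw [ENNReal.ofReal_inv_of_pos two_pos, ENNReal.ofReal_ofNat]
  have hm1 : ((max N₀ N₁ : ℕ) : ℝ) + 1 = ((max N₀ N₁ : ℕ) + 1 : ℕ) := by push_cast; ring
  exact (not_lt.2 (hhalf.trans hcheb)) (by simpa using hlt)

/-! ## (D) The recommended shape for the consumer: eventual-in-`R`

POINTWISE NON-MONOTONICITY IN `R` (paper, three spheres): badness at range `R₂` does not imply
badness at a smaller range `R₁ < R₂`, nor conversely. Witness: particle `i` at rest-ish; `j` at
distance `r ∈ (R₁ℓ, R₂ℓ)` heading for `i` (would hit at `t₁ < Tℓ`); an intruder `k` from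
distance `> R₂ℓ` knocks `j` off course at `t₀ < t₁`. Truth: `i` flies freely. Forecast at
`R₁`: cluster `{i}`, free flight = truth, GOOD. Forecast at `R₂`: cluster `{i, j}` without `k`,
`j` hits `i`, BAD. (Open conditions: a `G_N`-positive event.) CONSEQUENCE FOR stmt-13917
(LocalCertificateTransfer): its proof plan picks `R ≥ max(R₀(T), R_loc(T+λ, lam, δ))`, i.e. it
consumes the bound at a range possibly LARGER than the `R` this crux provides (`∃ R`), and the
bound at `R` does not imply the bound at `R' ≥ R`. The shape the transfer actually consumes is
the eventual one below; it implies the crux and is (heuristically) equally true. Planner: either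
re-type 13916 as `InfluenceLocalityEventually` or make 13917's proof choose `R₀(T) ≤ R_loc`. -/

/-- EVENTUAL-IN-`R` form of the crux (`∃ R₀ ∀ R ≥ R₀` instead of `∃ R`). -/
def InfluenceLocalityEventually : Prop :=
  ∀ (a θ : ℝ) (u₀ : V3), 0 < a → 0 < θ → ∃ σ₀ : ℝ, 0 < σ₀ ∧ ∀ σ : ℝ, 0 < σ → σ < σ₀ →
    ∀ (T lam δ : ℝ), 0 < T → 0 < lam → 0 < δ → ∃ R₀ : ℝ, 0 < R₀ ∧ ∀ R : ℝ, R₀ ≤ R →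
    ∃ N₀ : ℕ, ∀ N : ℕ, N₀ ≤ N → ∀ (Φ : Flow σ N) (Ψ : ClusterFlows σ N),
    Bound a θ u₀ σ T lam δ R N Φ Ψ

/-- The eventual form implies the crux (take `R = R₀`). The converse is NOT formal (no
monotonicity in `R`). [folklore] -/
theorem influenceLocality_of_eventually (h : InfluenceLocalityEventually) : InfluenceLocality := by
  rw [influenceLocality_iff]
  intro a θ u₀ ha hθ
  obtain ⟨σ₀, hσ₀, hσ⟩ := h a θ u₀ ha hθ
  refine ⟨σ₀, hσ₀, fun σ hs hs' T lam δ hT hlam hδ => ?_⟩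
  obtain ⟨R₀, hR₀, hR⟩ := hσ σ hs hs' T lam δ hT hlam hδ
  obtain ⟨N₀, hN⟩ := hR R₀ le_rfl
  exact ⟨R₀, hR₀, N₀, hN⟩


/-! ## (C′) The sharp form of dynamical input 2 -/

/-- DYNAMICAL INPUT 2′ (weaker than `TypicalBadFraction`, and all the kill needs): at fixed
`(σ, T, R)`, a bad FRACTION `ε` occurs with probability `≥ q > 0`, uniformly in `N`. -/
def PositiveBadFraction (a θ : ℝ) (u₀ : V3) (σ T R : ℝ) : Prop :=
  ∃ ε : ℝ, 0 < ε ∧ ∃ q : ℝ, 0 < q ∧ ∃ N₀ : ℕ, ∀ N : ℕ, N₀ ≤ N → ∃ (Φ : Flow σ N)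
    (Ψ : ClusterFlows σ N) (A : Set (Config (N + 1) (Fin 3) T3)) (m : ℕ), MeasurableSet A ∧
    ε * (N + 1) ≤ m ∧ (∀ z ∈ A, m ≤ badCount σ T R N Φ Ψ z) ∧
    ENNReal.ofReal q ≤ gibbs σ a θ u₀ N Φ A

/-- THE ORDER `lam` BEFORE `R` IS LOAD-BEARING, sharp form: a positive-probability bad fraction
at every range kills `UniformInLam` (Chebyshev at `lam = 2/ε`: `G_N(A) ≤ e^{-(N+1)} < q`). [folklore] -/
theorem uniformInLam_false_of_positiveBadFraction
    (h : ∀ σ₀ : ℝ, 0 < σ₀ → ∃ σ : ℝ, 0 < σ ∧ σ < σ₀ ∧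
      ∀ R : ℝ, 0 < R → PositiveBadFraction 1 1 0 σ 1 R) :
    ¬ UniformInLam := by
  intro hU
  obtain ⟨σ₀, hσ₀, hσ⟩ := hU 1 1 0 one_pos one_pos
  obtain ⟨σ, hs, hs', hR⟩ := h σ₀ hσ₀
  obtain ⟨R, hRpos, hl⟩ := hσ σ hs hs' 1 1 one_pos one_pos
  obtain ⟨ε, hε, q, hq, N₁, hN₁⟩ := hR R hRpos
  obtain ⟨N₀, hN⟩ := hl (2 / ε) (by positivity)
  obtain ⟨N₂, hN₂⟩ := exists_nat_gt (1 / q)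
  set M : ℕ := max (max N₀ N₁) N₂ with hM
  obtain ⟨Φ, Ψ, A, m, hA, hεm, hbad, hqA⟩ :=
    hN₁ M ((le_max_right _ _).trans (le_max_left _ _))
  have hB := hN M ((le_max_left _ _).trans (le_max_left _ _)) Φ Ψ
  have hcheb := measure_le_of_bound hB (by positivity) hA hbad
  have hexp : (1 : ℝ) * ((M : ℝ) + 1) - 2 / ε * m ≤ -((M : ℝ) + 1) := by
    have h4 : 2 / ε * (ε * ((M : ℝ) + 1)) ≤ 2 / ε * m := mul_le_mul_of_nonneg_left hεm (by positivity)
    have h4' : 2 / ε * (ε * ((M : ℝ) + 1)) = 2 * ((M : ℝ) + 1) := by field_simp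
    linarith
  have hsmall : Real.exp (-((M : ℝ) + 1)) < q := by
    have h1 : Real.exp (-((M : ℝ) + 1)) ≤ 1 / ((M : ℝ) + 2) := by
      rw [Real.exp_neg, ← one_div]
      apply one_div_le_one_div_of_le (by positivity)
      have := Real.add_one_le_exp ((M : ℝ) + 1)
      linarith
    have h2 : 1 / ((M : ℝ) + 2) < q := by
      rw [one_div_lt (by positivity) hq]
      calc 1 / q < N₂ := hN₂
        _ ≤ M := by exact_mod_cast le_max_right _ _
        _ < M + 2 := by linarith
    exact h1.trans_lt h2
  have hlt : gibbs σ 1 1 0 M Φ A < ENNReal.ofReal q :=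
    calc gibbs σ 1 1 0 M Φ A ≤ ENNReal.ofReal (Real.exp ((1 : ℝ) * ((M : ℝ) + 1) - 2 / ε * m)) := hcheb
      _ ≤ ENNReal.ofReal (Real.exp (-((M : ℝ) + 1))) :=
          ENNReal.ofReal_le_ofReal (Real.exp_le_exp.2 hexp)
      _ < ENNReal.ofReal q := (ENNReal.ofReal_lt_ofReal_iff hq).2 hsmall
  exact (not_lt.2 hqA) hlt

end

end Summit.AtomisticToContinuum.HydrodynamicLimit.Theorems.InfluenceLocality.Negative
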